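import Summits.AtomisticToContinuum.HydrodynamicLimit.Theorems.InformationPercolationEnginePercolationClosesChaosForecastDefs
import Literature.MathematicalPhysics.KineticTheory.HardSphereTotalDisplacement
import HarnessLib

/-!
# Docking S7 of the line `equilibrium-forecast-chain-rule` (crux `InformationPercolationEngine.PercolationClosesChaos`,
stmt-AtomisticToContinuum-15178) — piece B: the finite box of kinetic cells, cell centres, unit averages as finite sums

Support file (`--supports stmt-AtomisticToContinuum-15178`) of the registered stub `stub_docking` (worker S7 of lead c1).
The line's vocabulary indexes kinetic cells by ALL of `ℤ³` (`Cell`) and averages with `∑' q : Cell`; every realised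
statistic of a step (`collPair`, `rowCount`, `ownedCount`, `badWeight`, …) is supported in the finite box of cells met by
`cellOf` (`Torus.coarseCell` reads the symmetric representative in `(-1/2, 1/2]³`), so the `tsum`s are honest finite sums
and the unit average `unitAvg` is `K⁻¹ h³ Σ_{k<K} Σ_{q ∈ box}`. This file provides that bookkeeping:

* `cellBox h`, `cellOf_mem_cellBox`, `startCell_mem_cellBox`, `card_cellBox_mul_le` (`h³ · #box ≤ 27` for `0 < h ≤ 1`);
* `euclidDist_cellCentre_le`: a point is within `(√3/2) h` (minimal-image distance) of the centre of its cell;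
* vanishing off the box: `collPair_eq_zero_of_not_mem`, `rowCount_eq_zero_of_not_mem`, `ownedCount_eq_zero_of_not_mem`;
* `tsum_cell_eq_sum`, `unitAvg_eq_sum` (registered helper): the unit average of a box-supported family is the finite sum
  `K⁻¹ h³ Σ_{k<K} Σ_{q ∈ cellBox h} F k q`;
* kinetic units: `stepLen_pos`, `cellCount_pos`, `numSteps_mul_stepLen_le`, `pairWeight_mul_cellCount'`
  (`ε_N/(N+1) · (n̄ c) = π σ³ Δ_N h³`, from `VelocityBlindPlacement.pairWeight_mul_cellCount`).

Elementary (floors, `Fintype.piFinset`, `tsum_eq_sum`); no dynamics beyond the definition of `startCell`.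
-/

noncomputable section

open MeasureTheory Set Filter Topology
open scoped ENNReal BigOperators Classical
open Literature.Analysis.FluidPDE Literature.MathematicalPhysics.KineticTheory
open Literature.MathematicalPhysics.KineticTheory.VelocityBlindPlacement

namespace Summit.AtomisticToContinuum.HydrodynamicLimit.Theorems.EquilibriumForecastLine

/-! ## Kinetic units -/

/-- The step length `Δ_N = c ℓ_N` is positive for `c, σ > 0`. [folklore] -/
theorem stepLen_pos {c σ : ℝ} (hc : 0 < c) (hσ : 0 < σ) (N : ℕ) : 0 < stepLen c σ N :=
  mul_pos hc (meanFreePath_pos hσ N)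

/-- The cell count `n̄ = (N+1)(cℓ_N)³` is positive for `c, σ > 0`. [folklore] -/
theorem cellCount_pos {c σ : ℝ} (hc : 0 < c) (hσ : 0 < σ) (N : ℕ) : 0 < cellCount c σ N := by
  unfold cellCount
  have := meanFreePath_pos hσ N
  positivity

/-- The complete steps fit in the horizon: `K_N Δ_N ≤ τ` (`0 ≤ τ`). [folklore] -/
theorem numSteps_mul_stepLen_le {c σ τ : ℝ} (hc : 0 < c) (hσ : 0 < σ) (hτ : 0 ≤ τ) (N : ℕ) :
    (numSteps c σ N τ : ℝ) * stepLen c σ N ≤ τ := by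
  have hΔ := stepLen_pos hc hσ N
  unfold numSteps
  rw [← le_div_iff₀ hΔ]
  exact Nat.floor_le (div_nonneg hτ hΔ.le)

/-- The horizon is covered by `K_N + 1` steps: `τ < (K_N + 1) Δ_N`. [folklore] -/
theorem lt_numSteps_succ_mul_stepLen {c σ : ℝ} (hc : 0 < c) (hσ : 0 < σ) (τ : ℝ) (N : ℕ) :
    τ < ((numSteps c σ N τ : ℝ) + 1) * stepLen c σ N := by
  have hΔ := stepLen_pos hc hσ N
  unfold numSteps
  rw [← div_lt_iff₀ hΔ]
  exact Nat.lt_floor_add_one _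

/-- **The pair-weight dictionary** in the line's notation: `ε_N/(N+1) · (n̄ c) = π σ³ · Δ_N · (cℓ_N)³`. [folklore] -/
theorem pairWeight_mul_cellCount' (σ c : ℝ) (N : ℕ) :
    hsDiameter σ N / ((N : ℝ) + 1) * (cellCount c σ N * c) =
      Real.pi * σ ^ 3 * stepLen c σ N * (c * meanFreePath σ N) ^ 3 :=
  VelocityBlindPlacement.pairWeight_mul_cellCount σ c N

/-! ## The finite box of cells -/

/-- The finite box of cell indices met by the cell map at mesh `h`: `{⌊-1/(2h)⌋, …, ⌊1/(2h)⌋}³`. -/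
def cellBox (h : ℝ) : Finset Cell :=
  Fintype.piFinset fun _ : Fin 3 => Finset.Icc (⌊-(1 / 2 : ℝ) / h⌋) (⌊(1 / 2 : ℝ) / h⌋)

/-- Every point of the torus lies in a cell of the box (`reprSym ∈ (-1/2, 1/2]³`). [folklore] -/
theorem coarseCell_mem_cellBox {h : ℝ} (hh : 0 < h) (x : T3) : Torus.coarseCell h x ∈ cellBox h := by
  rw [cellBox, Fintype.mem_piFinset]
  intro m
  rw [Finset.mem_Icc]
  have hm := Torus.reprSym_apply_mem_Ioc x m
  exact ⟨Int.floor_le_floor (div_le_div_of_nonneg_right hm.1.le hh.le),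
    Int.floor_le_floor (div_le_div_of_nonneg_right hm.2 hh.le)⟩

/-- The kinetic cell of a point lies in the box. [folklore] -/
theorem cellOf_mem_cellBox {c σ : ℝ} {N : ℕ} (h : 0 < c * meanFreePath σ N) (x : T3) :
    cellOf c σ N x ∈ cellBox (c * meanFreePath σ N) :=
  coarseCell_mem_cellBox h x

/-- Start cells lie in the box. [folklore] -/
theorem startCell_mem_cellBox {c σ : ℝ} {N : ℕ} (h : 0 < c * meanFreePath σ N) (Φ : Flow σ N) (k : ℕ)
    (z : Phase N) (i : Fin (N + 1)) : startCell c σ N Φ k z i ∈ cellBox (c * meanFreePath σ N) :=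
  cellOf_mem_cellBox h _

/-- **Size of the box**: `h³ · #cellBox h ≤ (1 + 2h)³ ≤ 27` for `0 < h ≤ 1`. [folklore] -/
theorem card_cellBox_mul_le {h : ℝ} (h0 : 0 < h) (h1 : h ≤ 1) : h ^ 3 * ((cellBox h).card : ℝ) ≤ 27 := by
  have hside : ((Finset.Icc (⌊-(1 / 2 : ℝ) / h⌋) (⌊(1 / 2 : ℝ) / h⌋)).card : ℝ) ≤ 1 / h + 2 := by
    rw [Int.card_Icc]
    have hlo : (-(1 / 2 : ℝ) / h) - 1 < ⌊-(1 / 2 : ℝ) / h⌋ := Int.sub_one_lt_floor _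
    have hhi : (⌊(1 / 2 : ℝ) / h⌋ : ℝ) ≤ (1 / 2 : ℝ) / h := Int.floor_le _
    have hnn : (0 : ℝ) ≤ 1 / h + 2 := by positivity
    have key : ((⌊(1 / 2 : ℝ) / h⌋ + 1 - ⌊-(1 / 2 : ℝ) / h⌋ : ℤ) : ℝ) ≤ 1 / h + 2 := by
      push_cast
      have : (1 / 2 : ℝ) / h - (-(1 / 2 : ℝ) / h) = 1 / h := by ring
      linarith
    rcases le_or_gt 0 (⌊(1 / 2 : ℝ) / h⌋ + 1 - ⌊-(1 / 2 : ℝ) / h⌋) with hz | hz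
    · have hcast : (((⌊(1 / 2 : ℝ) / h⌋ + 1 - ⌊-(1 / 2 : ℝ) / h⌋).toNat : ℕ) : ℝ) =
          ((⌊(1 / 2 : ℝ) / h⌋ + 1 - ⌊-(1 / 2 : ℝ) / h⌋ : ℤ) : ℝ) := by
        rw [← Int.cast_natCast, Int.toNat_of_nonneg hz]
      rw [hcast]
      exact key
    · rw [Int.toNat_eq_zero.2 hz.le]
      simpa using hnn
  have hcard : ((cellBox h).card : ℝ) ≤ (1 / h + 2) ^ 3 := by
    rw [cellBox, Fintype.card_piFinset, Finset.prod_const, Finset.card_univ, Fintype.card_fin]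
    push_cast
    exact pow_le_pow_left₀ (Nat.cast_nonneg _) hside 3
  calc h ^ 3 * ((cellBox h).card : ℝ) ≤ h ^ 3 * (1 / h + 2) ^ 3 := by gcongr
    _ = (1 + 2 * h) ^ 3 := by rw [← mul_pow]; congr 1; field_simp
    _ ≤ (1 + 2 * 1) ^ 3 := by gcongr
    _ = 27 := by norm_num

/-! ## Cell centres -/

/-- **A point is within half a cell diagonal of the centre of its cell**: `dist(x, centre (cellOf x)) ≤ (√3/2) h`
(minimal-image distance; `h = cℓ_N`). [folklore] -/
theorem euclidDist_cellCentre_le {c σ : ℝ} {N : ℕ} (h : 0 < c * meanFreePath σ N) (x : T3) :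
    Torus.euclidDist x (cellCentre c σ N (cellOf c σ N x)) ≤ Real.sqrt 3 / 2 * (c * meanFreePath σ N) := by
  set hh := c * meanFreePath σ N with hdef
  set v : EuclideanSpace ℝ (Fin 3) :=
    WithLp.toLp 2 fun m : Fin 3 => (((cellOf c σ N x m : ℤ) : ℝ) + 2⁻¹) * hh with hv
  have hx : x = Literature.Analysis.FunctionSpaces.Torus.proj (Torus.reprSym x) := (Torus.proj_reprSym x).symm
  have hcentre : cellCentre c σ N (cellOf c σ N x) = Literature.Analysis.FunctionSpaces.Torus.proj v := rfl
  rw [hcentre, hx, Torus.proj_reprSym]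
  conv_lhs => rw [hx]
  refine (Torus.euclidDist_proj_le_norm_sub_holds _ _).trans ?_
  have hcoord : ∀ m : Fin 3, |Torus.reprSym x m - v m| ≤ hh / 2 := by
    intro m
    have hq : (cellOf c σ N x m : ℝ) = ⌊Torus.reprSym x m / hh⌋ := by
      simp [cellOf, Torus.coarseCell, hdef]
    have h1 : (⌊Torus.reprSym x m / hh⌋ : ℝ) ≤ Torus.reprSym x m / hh := Int.floor_le _
    have h2 : Torus.reprSym x m / hh < ⌊Torus.reprSym x m / hh⌋ + 1 := Int.lt_floor_add_one _
    have hvm : v m = ((⌊Torus.reprSym x m / hh⌋ : ℝ) + 2⁻¹) * hh := by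
      rw [hv, PiLp.toLp_apply, hq]
    rw [hvm, abs_le]
    rw [le_div_iff₀ h] at h1
    rw [div_lt_iff₀ h] at h2
    constructor <;> nlinarith
  have hsq : ‖Torus.reprSym x - v‖ ^ 2 ≤ (Real.sqrt 3 / 2 * hh) ^ 2 := by
    rw [EuclideanSpace.norm_eq, Real.sq_sqrt (Finset.sum_nonneg fun _ _ => sq_nonneg _)]
    calc ∑ m, ‖(Torus.reprSym x - v) m‖ ^ 2 ≤ ∑ _m : Fin 3, (hh / 2) ^ 2 :=
          Finset.sum_le_sum fun m _ => by
            rw [Real.norm_eq_abs, PiLp.sub_apply]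
            exact pow_le_pow_left₀ (abs_nonneg _) (hcoord m) 2
      _ = (Real.sqrt 3 / 2 * hh) ^ 2 := by
          have h3 : Real.sqrt 3 ^ 2 = 3 := Real.sq_sqrt (by norm_num : (0:ℝ) ≤ 3)
          rw [Finset.sum_const, Finset.card_univ, Fintype.card_fin, nsmul_eq_mul, mul_pow, div_pow, div_pow, h3]
          push_cast
          ring
  have hnn : 0 ≤ Real.sqrt 3 / 2 * hh := by positivity
  exact (pow_le_pow_iff_left₀ (norm_nonneg _) hnn two_ne_zero).1 hsq

/-! ## Finite support in the box -/

/-- A `tsum` over cells of a family vanishing off a finite set is the finite sum. [folklore] -/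
theorem tsum_cell_eq_sum {f : Cell → ℝ} {B : Finset Cell} (hf : ∀ q ∉ B, f q = 0) :
    ∑' q, f q = ∑ q ∈ B, f q :=
  tsum_eq_sum hf

/-- A collision pair sum along the flow with identically vanishing summand vanishes. [folklore] -/
theorem collisionPairSum_zero_fun {σ : ℝ} {N : ℕ} (Φ : Flow σ N) (S : Set ℝ) (z : Phase N) :
    Φ.collisionPairSum S (fun _ _ _ _ => (0 : ℝ)) z = 0 := by
  unfold HardSphereFlow.collisionPairSum Literature.Analysis.FluidPDE.collisionPairSum
  simp

/-- `collPair` vanishes unless both cells are in the box. [folklore] -/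
theorem collPair_eq_zero_of_not_mem {c σ : ℝ} {N : ℕ} (h : 0 < c * meanFreePath σ N) (Ψ : V3 × V3 × V3 → ℝ)
    (Φ : Flow σ N) (k : ℕ) {q q' : Cell}
    (hq : q ∉ cellBox (c * meanFreePath σ N) ∨ q' ∉ cellBox (c * meanFreePath σ N)) (z : Phase N) :
    collPair Ψ c σ N Φ k q q' z = 0 := by
  unfold collPair
  have hfun : (fun (_ : ℝ) (w : Phase N) (i j : Fin (N + 1)) =>
      if startCell c σ N Φ k z i = q ∧ startCell c σ N Φ k z j = q' then Ψ (markOf N (hsDiameter σ N) w i j) else 0) =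
      fun _ _ _ _ => (0 : ℝ) := by
    funext s w i j
    rw [if_neg]
    rintro ⟨hi, hj⟩
    rcases hq with hq | hq
    · exact hq (hi ▸ startCell_mem_cellBox h Φ k z i)
    · exact hq (hj ▸ startCell_mem_cellBox h Φ k z j)
  rw [hfun, collisionPairSum_zero_fun, mul_zero]

/-- `rowCount` vanishes off the box. [folklore] -/
theorem rowCount_eq_zero_of_not_mem {c σ : ℝ} {N : ℕ} (h : 0 < c * meanFreePath σ N) (Φ : Flow σ N) (k : ℕ)
    {q : Cell} (hq : q ∉ cellBox (c * meanFreePath σ N)) (z : Phase N) :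
    rowCount c σ N Φ k q z = 0 := by
  unfold rowCount
  have hfun : (fun (_ : ℝ) (_ : Phase N) (i _ : Fin (N + 1)) =>
      if startCell c σ N Φ k z i = q then (1 : ℝ) else 0) = fun _ _ _ _ => (0 : ℝ) := by
    funext s w i j
    rw [if_neg]
    intro hi
    exact hq (hi ▸ startCell_mem_cellBox h Φ k z i)
  rw [hfun, collisionPairSum_zero_fun, mul_zero]

/-- The lexicographic minimum of two cells is one of them. [folklore] -/
theorem cellMin_mem_pair (p q : Cell) : cellMin p q = p ∨ cellMin p q = q := by
  unfold cellMin
  split_ifs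
  · exact Or.inr rfl
  · exact Or.inl rfl

/-- `ownedCount` vanishes off the box. [folklore] -/
theorem ownedCount_eq_zero_of_not_mem {c σ : ℝ} {N : ℕ} (h : 0 < c * meanFreePath σ N) (Φ : Flow σ N) (k : ℕ)
    {q : Cell} (hq : q ∉ cellBox (c * meanFreePath σ N)) (z : Phase N) :
    ownedCount c σ N Φ k q z = 0 := by
  unfold ownedCount
  have hfun : (fun (_ : ℝ) (_ : Phase N) (i j : Fin (N + 1)) =>
      if cellMin (startCell c σ N Φ k z i) (startCell c σ N Φ k z j) = q then (1 : ℝ) else 0) =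
      fun _ _ _ _ => (0 : ℝ) := by
    funext s w i j
    rw [if_neg]
    intro hi
    rcases cellMin_mem_pair (startCell c σ N Φ k z i) (startCell c σ N Φ k z j) with hm | hm
    · rw [hm] at hi
      exact hq (hi ▸ startCell_mem_cellBox h Φ k z i)
    · rw [hm] at hi
      exact hq (hi ▸ startCell_mem_cellBox h Φ k z j)
  rw [hfun, collisionPairSum_zero_fun, mul_zero]

/-- `badWeight` vanishes off the box (`0 ≤ T`). [folklore] -/
theorem badWeight_eq_zero_of_not_mem {c σ : ℝ} {N : ℕ} (h : 0 < c * meanFreePath σ N) (Ψ : V3 × V3 × V3 → ℝ)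
    (η : ℝ) {T : ℝ} (hT : 0 ≤ T) (Φ : Flow σ N) (k : ℕ) {q : Cell} (hq : q ∉ cellBox (c * meanFreePath σ N))
    (z : Phase N) : badWeight Ψ η T c σ N Φ k q z = 0 := by
  unfold badWeight
  rw [ownedCount_eq_zero_of_not_mem h Φ k hq z, min_eq_left hT, zero_mul]

/-- `rowCount ≥ 0`. [folklore] -/
theorem rowCount_nonneg {c σ : ℝ} {N : ℕ} (hc : 0 ≤ c) (hσ : 0 < σ) (Φ : Flow σ N) (k : ℕ) (q : Cell) (z : Phase N) :
    0 ≤ rowCount c σ N Φ k q z := by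
  unfold rowCount
  refine mul_nonneg (inv_nonneg.2 (mul_nonneg ?_ hc)) (collisionPairSum_nonneg fun _ _ _ => by positivity)
  unfold cellCount
  have := meanFreePath_pos hσ N
  positivity

/-- `ownedCount ≥ 0`. [folklore] -/
theorem ownedCount_nonneg {c σ : ℝ} {N : ℕ} (hc : 0 ≤ c) (hσ : 0 < σ) (Φ : Flow σ N) (k : ℕ) (q : Cell) (z : Phase N) :
    0 ≤ ownedCount c σ N Φ k q z := by
  unfold ownedCount
  refine mul_nonneg (inv_nonneg.2 (mul_nonneg ?_ hc)) (collisionPairSum_nonneg fun _ _ _ => by positivity)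
  unfold cellCount
  have := meanFreePath_pos hσ N
  positivity

/-- `collPair 1 ≥ 0`. [folklore] -/
theorem collPair_one_nonneg {c σ : ℝ} {N : ℕ} (hc : 0 ≤ c) (hσ : 0 < σ) (Φ : Flow σ N) (k : ℕ) (q q' : Cell)
    (z : Phase N) : 0 ≤ collPair (fun _ => 1) c σ N Φ k q q' z := by
  unfold collPair
  refine mul_nonneg (inv_nonneg.2 (mul_nonneg ?_ hc)) (collisionPairSum_nonneg fun _ _ _ => by positivity)
  unfold cellCount
  have := meanFreePath_pos hσ N
  positivity

/-- `badWeight ≥ 0` (`0 ≤ T`). [folklore] -/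
theorem badWeight_nonneg {c σ : ℝ} {N : ℕ} (hc : 0 ≤ c) (hσ : 0 < σ) (Ψ : V3 × V3 × V3 → ℝ) (η : ℝ) {T : ℝ}
    (hT : 0 ≤ T) (Φ : Flow σ N) (k : ℕ) (q : Cell) (z : Phase N) : 0 ≤ badWeight Ψ η T c σ N Φ k q z := by
  unfold badWeight
  exact mul_nonneg (le_min (ownedCount_nonneg hc hσ Φ k q z) hT) (by positivity)

/-! ## Unit averages as finite sums -/

/-- **Registered helper `unitAvg_eq_sum` (piece B of the docking S7): the unit average of a box-supported family is a
finite sum**, `unitAvg F = K_N⁻¹ (cℓ_N)³ Σ_{k<K_N} Σ_{q ∈ cellBox (cℓ_N)} F k q`. [folklore] -/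
theorem unitAvg_eq_sum : ∀ (c σ : ℝ) (N : ℕ) (τ : ℝ) (F : ℕ → Cell → ℝ), (∀ k, ∀ q ∉ cellBox (c * meanFreePath σ N), F k q = 0) → unitAvg c σ N τ F = ((numSteps c σ N τ : ℝ))⁻¹ * (c * meanFreePath σ N) ^ 3 * ∑ k ∈ Finset.range (numSteps c σ N τ), ∑ q ∈ cellBox (c * meanFreePath σ N), F k q := by
  intro c σ N τ F hF
  unfold unitAvg
  congr 1
  exact Finset.sum_congr rfl fun k _ => tsum_cell_eq_sum (hF k)

/-- The unit average of a nonnegative box-supported family is nonnegative. [folklore] -/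
theorem unitAvg_nonneg {c σ : ℝ} {N : ℕ} {τ : ℝ} {F : ℕ → Cell → ℝ} (hc : 0 ≤ c * meanFreePath σ N)
    (hF : ∀ k, ∀ q ∉ cellBox (c * meanFreePath σ N), F k q = 0) (hF0 : ∀ k q, 0 ≤ F k q) :
    0 ≤ unitAvg c σ N τ F := by
  rw [unitAvg_eq_sum c σ N τ F hF]
  have : 0 ≤ ∑ k ∈ Finset.range (numSteps c σ N τ), ∑ q ∈ cellBox (c * meanFreePath σ N), F k q :=
    Finset.sum_nonneg fun k _ => Finset.sum_nonneg fun q _ => hF0 k q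
  positivity

/-- Monotonicity of the unit average on box-supported families. [folklore] -/
theorem unitAvg_mono {c σ : ℝ} {N : ℕ} {τ : ℝ} {F G : ℕ → Cell → ℝ} (hc : 0 ≤ c * meanFreePath σ N)
    (hF : ∀ k, ∀ q ∉ cellBox (c * meanFreePath σ N), F k q = 0)
    (hG : ∀ k, ∀ q ∉ cellBox (c * meanFreePath σ N), G k q = 0) (hFG : ∀ k q, F k q ≤ G k q) :
    unitAvg c σ N τ F ≤ unitAvg c σ N τ G := by
  rw [unitAvg_eq_sum c σ N τ F hF, unitAvg_eq_sum c σ N τ G hG]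
  have : ∑ k ∈ Finset.range (numSteps c σ N τ), ∑ q ∈ cellBox (c * meanFreePath σ N), F k q ≤
      ∑ k ∈ Finset.range (numSteps c σ N τ), ∑ q ∈ cellBox (c * meanFreePath σ N), G k q :=
    Finset.sum_le_sum fun k _ => Finset.sum_le_sum fun q _ => hFG k q
  have h0 : 0 ≤ ((numSteps c σ N τ : ℝ))⁻¹ * (c * meanFreePath σ N) ^ 3 := by positivity
  exact mul_le_mul_of_nonneg_left this h0

/-- **The normalisation of a step sum**: `ε_N/(N+1) · (n̄ c) · Σ_{k<K} Σ_{q ∈ box} F k q = π σ³ (K Δ_N) · unitAvg F` for a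
box-supported family (so `≤ π σ³ τ · unitAvg F` when `F ≥ 0`). [folklore] -/
theorem pairWeight_mul_sum_eq_unitAvg {c σ : ℝ} {N : ℕ} {τ : ℝ} {F : ℕ → Cell → ℝ} (hc : 0 < c) (hσ : 0 < σ)
    (hK : 0 < numSteps c σ N τ) (hF : ∀ k, ∀ q ∉ cellBox (c * meanFreePath σ N), F k q = 0) :
    hsDiameter σ N / ((N : ℝ) + 1) * (cellCount c σ N * c) *
        ∑ k ∈ Finset.range (numSteps c σ N τ), ∑ q ∈ cellBox (c * meanFreePath σ N), F k q =
      Real.pi * σ ^ 3 * ((numSteps c σ N τ : ℝ) * stepLen c σ N) * unitAvg c σ N τ F := by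
  rw [pairWeight_mul_cellCount', unitAvg_eq_sum c σ N τ F hF]
  have hK' : (numSteps c σ N τ : ℝ) ≠ 0 := by exact_mod_cast hK.ne'
  field_simp

/-- The normalised step sum of a nonnegative box-supported family is at most `π σ³ τ` times its unit average. [folklore] -/
theorem pairWeight_mul_sum_le_unitAvg {c σ : ℝ} {N : ℕ} {τ : ℝ} {F : ℕ → Cell → ℝ} (hc : 0 < c) (hσ : 0 < σ)
    (hτ : 0 ≤ τ) (hF : ∀ k, ∀ q ∉ cellBox (c * meanFreePath σ N), F k q = 0) (hF0 : ∀ k q, 0 ≤ F k q) :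
    hsDiameter σ N / ((N : ℝ) + 1) * (cellCount c σ N * c) *
        ∑ k ∈ Finset.range (numSteps c σ N τ), ∑ q ∈ cellBox (c * meanFreePath σ N), F k q ≤
      Real.pi * σ ^ 3 * τ * unitAvg c σ N τ F := by
  have hu := unitAvg_nonneg (τ := τ) (mul_pos hc (meanFreePath_pos hσ N)).le hF hF0
  rcases Nat.eq_zero_or_pos (numSteps c σ N τ) with hK | hK
  · rw [hK, Finset.sum_range_zero, mul_zero]
    positivity
  rw [pairWeight_mul_sum_eq_unitAvg hc hσ hK hF]
  have hKΔ := numSteps_mul_stepLen_le hc hσ hτ N (τ := τ)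
  have : 0 ≤ Real.pi * σ ^ 3 := by positivity
  gcongr

end Summit.AtomisticToContinuum.HydrodynamicLimit.Theorems.EquilibriumForecastLine

end
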